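import Literature.MathematicalPhysics.QuantumLattice.DuhamelTwoPointProofs
import Literature.MathematicalPhysics.QuantumLattice.HubbardGaugeBound
import Literature.MathematicalPhysics.QuantumLattice.HubbardModelProofs
import HarnessLib

/-!
# Kubo–Kishi: Gaussian domination in spin space and interaction-dependent bounds on the
# susceptibilities of the Hubbard model at positive temperature

Trunk T-QLATTICE (family `hubbard`). K. Kubo, T. Kishi, *Rigorous bounds on the susceptibilities
of the Hubbard model*, Phys. Rev. B **41** (1990) 4866–4868 [KuboKishi1990] (reprinted in
A. Montorsi (ed.), *The Hubbard Model*, World Scientific 1992, pp. 120–122).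

Kubo–Kishi prove, by the Dyson–Lieb–Simon method of GAUSSIAN DOMINATION transplanted to "spin
space" (Trotter product + Hubbard–Stratonovich linearisation of `exp[-½β|U|(n_↑-n_↓-h)²]` +
Schwarz's inequality between the up- and down-spin traces, their eqs. (7)–(9)), that for the
ATTRACTIVE Hubbard model (`U < 0`, equal chemical potentials for both spins, arbitrary real
symmetric hopping, any filling, any finite lattice, any `β > 0`) the grand-canonical partition
function with a longitudinal field coupled through the interaction,
`Ξ({h}) = e^{-½β|U| Σ_x h_x²} Tr exp[-β(H - |U| Σ_x h_x (n_{x↑} - n_{x↓}))]`, satisfies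
`Ξ({h}) ≤ Ξ({0}) = Tr e^{-βH}` for all real `{h_x}` (proof of their Theorem 1). Consequences
(their Theorem 1, eq. (3), and Remark 1, eq. (4)): the static spin susceptibility obeys
`χ_q = β (S^z_q, S^z_{-q}) ≤ 1/(4|U|)` for every wave vector, and by the Falk–Bruch inequality
`⟨S^z_q S^z_{-q}⟩ ≤ ¼ C_q^{1/2} |U|^{-1/2} coth(β C_q^{1/2} |U|^{1/2})` with `C_q` any upper bound
on the double commutator. For the REPULSIVE model at half filling on a bipartite lattice
(`U > 0`, `μ = U/2`) the partial particle–hole transformation maps the statement onto the charge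
and on-site-pairing channels (their Theorem 2, eqs. (5), (6)): `β(δn_q, δn_{-q}) ≤ 1/U`,
`β(p_q, p_{-q}) ≤ 1/U` — no charge-density-wave and no on-site-pairing long-range order at any
`T > 0`, in any dimension, with an INTERACTION-DEPENDENT ceiling (the only such ceiling in print
for the Hubbard model; the Mermin–Wagner / Koma–Tasaki bounds are uniform in `U`).

This file records the two Gaussian-domination inequalities as NAMED FACTS (`def … : Prop`, used as
hypotheses; their proof needs operator-valued Hubbard–Stratonovich integrals over Trotter slices
and the `↑ ⊗ ↓` factorisation of the Fock space, not in the tree), in the Dyson–Lieb–Simon form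
`Z_β(H - M_a + (Σ_x a_x²/(2|U|))·1) ≤ Z_β(H)` consumed by the tree's
`Matrix.gaussianDomination_duhamel_le` (PROVED there: `gaussianDomination_duhamel_le_holds`), and
DERIVES from them, fully proved:

* `kuboKishi_spin_duhamel_le` / `kuboKishi_charge_duhamel_le` — the susceptibility bounds
  `(M_a, M_a)_β ≤ Σ_x a_x² /(β|U|)` for the spin field `M_a = Σ_x a_x (n_{x↑} - n_{x↓}) = 2Σ a_x S^z_x`
  (attractive, any `μ`) and for the charge field `D_a = Σ_x a_x (n_x - 1)` (repulsive, `μ = U/2`,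
  bipartite) — Kubo–Kishi (10), (3), (5) for arbitrary real test functions `a`;
* `kuboKishi_spin_falkBruch_le` / `kuboKishi_charge_falkBruch_le` — the Falk–Bruch transfer to the
  equal-time fluctuations, for any finite family `a_k`:
  `Σ_k ⟨M_{a_k}²⟩_β ≤ B/(β|U|) + ½ √((B/|U|) · Σ_k ⟨[M_{a_k}, [H, M_{a_k}]]⟩_β)`, `B = Σ_k Σ_x a_{k,x}²`
  (Kubo–Kishi's Remark 1 with `coth x ≤ 1 + 1/x`, the double commutator left symbolic exactly as
  their `C_q`; the companion text `pub-hubbard/paper/bounds.tex` Thm 11 evaluates it by the f-sum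
  rule: `⟨[M_a,[H,M_a]]⟩ = Σ_{bonds b = {x,y}} (a_x - a_y)² e_b`, `e_b = -⟨T_b⟩_β ≤ 2|t|` the bond
  kinetic energy, giving e.g. `S^{zz}(q) ≤ 1/(4β|U|) + ¼√(ε_q |t|/|U|)`, `ε_q = Σ_i (1 - cos q_i)`);
* `kuboKishi_charge_duhamel_le_torus`, `kuboKishi_charge_falkBruch_le_torus` — the repulsive
  statements on the torus `(ℤ/Lℤ)^d`, `L` even (bipartite sign `torusStagger`), every `d ≥ 1`.

Relation to the tree: the `T = 0`, half-filled version of Kubo–Kishi's charge/pairing bound (Lieb's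
spin-space reflection positivity + Gaussian domination for the ground state) is PROVED under
`Summits/HubbardSuperconductivity/HubbardSuperconductivity/Theorems/LiebTwinNoOnsiteODLROHalfFilling*`
(`gaussianDomination_halfFilled`, `chargeFluctuation_falkBruch`); the Shiba map
`S (H(t,U) - (U/2)N) Sᴴ = H(t,-U) + (U/2)N - (U/2)|Λ|` that turns the charge fact into the spin fact
is `shiba_operator_identity` (cell Theorems) / `partialParticleHole_conj_hamiltonianWith`
(Literature). Later extensions of the charge bound (not formalised here): T. Miyao, Ann. Henri
Poincaré 18 (2017) 193 / arXiv:1402.5202, Thm 1.6 (Holstein–Hubbard and general positive-definite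
Coulomb repulsion: `χ_β(p) ≤ Û_eff(p)^{-1}`); arXiv:1405.0112, Thm 1.2 (coupling to the quantised
radiation field).

References: [KuboKishi1990] Theorems 1, 2, eqs. (3)–(10), Remarks 1–5; [DLS1978] Thm 3.1, eq. (44);
[LSSY2005] Ch. 11; H. Falk, L. W. Bruch, Phys. Rev. 180 (1969) 442.
-/

noncomputable section

namespace Literature.MathematicalPhysics.QuantumLattice

open Matrix Finset HubbardWave0
open scoped Matrix.Norms.L2Operator ComplexOrder

/-! ### The field operators coupled through the interaction -/

section Fields

variable {Λ : Type*} [LinearOrder Λ] [Fintype Λ]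

/-- The longitudinal SPIN field operator `M_a = Σ_x a_x (n_{x↑} - n_{x↓}) = 2 Σ_x a_x S^z_x` for a
real test function `a` (Kubo–Kishi's `Σ_α h_α (n_{α↑} - n_{α↓})` in eq. (7), `a = |U| h`).
[cite: KuboKishi1990, eq. (7)] -/
def spinDensityField (a : Λ → ℝ) : Matrix (Finset (Orb Λ)) (Finset (Orb Λ)) ℂ :=
  ∑ x : Λ, (a x : ℂ) • (numberOp x 0 - numberOp x 1)

/-- The CHARGE field operator `D_a = Σ_x a_x (n_{x↑} + n_{x↓} - 1) = 2 Σ_x a_x J^z_x`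
(`J^z_x = (n_x - 1)/2` the pseudospin; at half filling `n_x - 1 = δn_x = n_x - ⟨n_x⟩`,
Kubo–Kishi Remark 2). [cite: KuboKishi1990, Theorem 2 and Remark 2] -/
def chargeDensityField (a : Λ → ℝ) : Matrix (Finset (Orb Λ)) (Finset (Orb Λ)) ℂ :=
  ∑ x : Λ, (a x : ℂ) • (numberOp x 0 + numberOp x 1 - 1)

/-- `M_{τa} = τ M_a` (plumbing). [folklore] -/
private theorem spinDensityField_smul (τ : ℝ) (a : Λ → ℝ) :
    spinDensityField (fun x => τ * a x) = (τ : ℂ) • spinDensityField a := by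
  unfold spinDensityField
  rw [Finset.smul_sum]
  refine sum_congr rfl fun x _ => ?_
  rw [Complex.ofReal_mul, mul_smul]

/-- `D_{τa} = τ D_a` (plumbing). [folklore] -/
private theorem chargeDensityField_smul (τ : ℝ) (a : Λ → ℝ) :
    chargeDensityField (fun x => τ * a x) = (τ : ℂ) • chargeDensityField a := by
  unfold chargeDensityField
  rw [Finset.smul_sum]
  refine sum_congr rfl fun x _ => ?_
  rw [Complex.ofReal_mul, mul_smul]

/-- `M_a = 2 Σ_x a_x S^z_x` is Hermitian (a real combination of the Hermitian `S^z_x` of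
Kubo–Kishi's eq. (2); "represented by real matrices", their proof of Theorem 1).
[cite: KuboKishi1990, eqs. (2), (7)] -/
theorem isHermitian_spinDensityField (a : Λ → ℝ) : (spinDensityField a).IsHermitian := by
  have hn : ∀ (x : Λ) (τ : Fin 2), (numberOp x τ)ᴴ = numberOp x τ := fun x τ =>
    (numberAt_isHermitian (orb x τ)).eq
  unfold spinDensityField Matrix.IsHermitian
  rw [conjTranspose_sum]
  refine sum_congr rfl fun x _ => ?_
  rw [conjTranspose_smul, conjTranspose_sub, hn, hn, Complex.star_def, Complex.conj_ofReal]

/-- `D_a = Σ_x a_x (n_x - 1)` is Hermitian (a real combination of the Hermitian `δn_x` of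
Kubo–Kishi's Theorem 2). [cite: KuboKishi1990, Theorem 2, eq. (5)] -/
theorem isHermitian_chargeDensityField (a : Λ → ℝ) : (chargeDensityField a).IsHermitian := by
  have hn : ∀ (x : Λ) (τ : Fin 2), (numberOp x τ)ᴴ = numberOp x τ := fun x τ =>
    (numberAt_isHermitian (orb x τ)).eq
  unfold chargeDensityField Matrix.IsHermitian
  rw [conjTranspose_sum]
  refine sum_congr rfl fun x _ => ?_
  rw [conjTranspose_smul, conjTranspose_sub, conjTranspose_add, hn, hn, conjTranspose_one,
    Complex.star_def, Complex.conj_ofReal]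

omit [LinearOrder Λ] in
/-- `Σ_x (τ a_x)² = τ² Σ_x a_x²` (plumbing). [folklore] -/
private theorem sum_sq_mul (τ : ℝ) (a : Λ → ℝ) : (∑ x, (τ * a x) ^ 2) = τ ^ 2 * ∑ x, a x ^ 2 := by
  rw [Finset.mul_sum]
  exact sum_congr rfl fun x _ => by ring

end Fields

/-! ### The named facts: Gaussian domination in spin space (Kubo–Kishi, proofs of Thms 1 and 2) -/

/-- **Kubo–Kishi's Gaussian domination for the ATTRACTIVE Hubbard model (named fact).** For every
finite graph, all real `t`, every `U < 0`, every (spin-independent) chemical potential `μ`, every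
`β > 0` and every real test function `a` on the sites:
`Z_β(H(t,U) - μN - M_a + (Σ_x a_x²/(2|U|))·1) ≤ Z_β(H(t,U) - μN)`, `M_a = Σ_x a_x (n_{x↑} - n_{x↓})`
— this is `Ξ({h_α}) ≤ Ξ` of the proof of their Theorem 1 (eq. (7) with `h_α = a_α/|U|`; proved
by Trotter's formula, the Hubbard–Stratonovich identity `e^{-A²} = (4π)^{-1/2}∫ e^{ikA} e^{-k²/4} dk`
and Schwarz's inequality between the up- and down-spin traces, eqs. (8), (9)). Kubo–Kishi allow
arbitrary real symmetric hopping `t_{αβ}` and site-dependent `μ_α`; the uniform-hopping graph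
Hamiltonian `hamiltonianWith G t U μ` is the case recorded here. Stated on the real parts of the
(real) partition functions, the form consumed by `Matrix.gaussianDomination_duhamel_le`.
[cite: KuboKishi1990, proof of Theorem 1, eq. (7) and the inequality Ξ({h_α}) ≤ Ξ] -/
def kuboKishi_spin_gaussianDomination : Prop :=
  ∀ (Λ : Type) [LinearOrder Λ] [Fintype Λ] (G : SimpleGraph Λ) [DecidableRel G.Adj]
    (t U μ β : ℝ), U < 0 → 0 < β → ∀ a : Λ → ℝ,
      (partitionFn β (hamiltonianWith G t U μ - spinDensityField a +
          (((∑ x, a x ^ 2) / (2 * |U|) : ℝ) : ℂ) •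
            (1 : Matrix (Finset (Orb Λ)) (Finset (Orb Λ)) ℂ))).re ≤
        (partitionFn β (hamiltonianWith G t U μ)).re

/-- **Kubo–Kishi's Gaussian domination for the REPULSIVE HALF-FILLED Hubbard model on a bipartite
graph (named fact).** For every finite graph admitting a bipartite sign `ε` (`ε_x = -ε_y` on every
edge), all real `t`, every `U > 0`, `μ = U/2` (half filling: `⟨n_x⟩ = 1`, their Remark 2), every
`β > 0` and every real `a`: `Z_β(H(t,U) - (U/2)N - D_a + (Σ_x a_x²/(2U))·1) ≤ Z_β(H(t,U) - (U/2)N)`,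
`D_a = Σ_x a_x (n_x - 1)` — the proof of their Theorem 2: the partial particle–hole transformation
`c_{x↓} ↦ ε_x c†_{x↓}` maps `H(t,U) - (U/2)N` to the attractive model `H(t,-U) + (U/2)N - (U/2)|Λ|`
and `n_x - 1` to `n_{x↑} - n_{x↓}`, so this is the previous fact transported (in the tree the map is
`shiba_operator_identity` / `partialParticleHole_conj_hamiltonianWith`).
[cite: KuboKishi1990, proof of Theorem 2] -/
def kuboKishi_charge_gaussianDomination : Prop :=
  ∀ (Λ : Type) [LinearOrder Λ] [Fintype Λ] (G : SimpleGraph Λ) [DecidableRel G.Adj] (ε : Λ → ℤˣ),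
    (∀ x y, G.Adj x y → ε x = -ε y) → ∀ (t U β : ℝ), 0 < U → 0 < β → ∀ a : Λ → ℝ,
      (partitionFn β (hamiltonianWith G t U (U / 2) - chargeDensityField a +
          (((∑ x, a x ^ 2) / (2 * U) : ℝ) : ℂ) •
            (1 : Matrix (Finset (Orb Λ)) (Finset (Orb Λ)) ℂ))).re ≤
        (partitionFn β (hamiltonianWith G t U (U / 2))).re

/-! ### Consequences, proved: the susceptibility bounds (Kubo–Kishi (10), (3), (5)) -/

section Consequences

variable {Λ : Type} [LinearOrder Λ] [Fintype Λ] (G : SimpleGraph Λ) [DecidableRel G.Adj]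

/-- **Kubo–Kishi (10)/(3), the spin susceptibility bound of the attractive model (PROVED from the
named fact).** For `U < 0`, any `μ`, `β > 0` and every real `a`:
`(M_a, M_a)_β ≤ Σ_x a_x² /(β|U|)`, i.e. `β (S^z_a, S^z_a) ≤ Σ_x a_x²/(4|U|)` for
`S^z_a = Σ_x a_x S^z_x` — with `a_x = |Λ|^{-1/2} cos(q·x)`, `sin(q·x)` this is `χ_q ≤ 1/(4|U|)`
(their (3)). Proof: `Matrix.gaussianDomination_duhamel_le` (Dyson–Lieb–Simon (44), proved in the
tree) applied to `t ↦ M_{ta} = t M_a`. [cite: KuboKishi1990, Theorem 1, eqs. (3), (10)] -/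
theorem kuboKishi_spin_duhamel_le (hKK : kuboKishi_spin_gaussianDomination) {t U μ β : ℝ}
    (hU : U < 0) (hβ : 0 < β) (a : Λ → ℝ) :
    (duhamel β (hamiltonianWith G t U μ) (spinDensityField a) (spinDensityField a)).re ≤
      (∑ x, a x ^ 2) / |U| / β := by
  refine gaussianDomination_duhamel_le_holds (Finset (Orb Λ)) β hβ _ _
    (isHermitian_hamiltonianWith G t U μ) (isHermitian_spinDensityField a) _ fun τ => ?_
  have h := hKK Λ G t U μ β hU hβ (fun x => τ * a x)
  have hc : (∑ x, (τ * a x) ^ 2) / (2 * |U|) = τ ^ 2 * ((∑ x, a x ^ 2) / |U|) / 2 := by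
    rw [sum_sq_mul]; ring
  rw [spinDensityField_smul, hc] at h
  exact h

/-- **Kubo–Kishi (5), the charge susceptibility bound of the repulsive half-filled model on a
bipartite graph (PROVED from the named fact).** For `U > 0`, `μ = U/2`, a bipartite sign `ε`,
`β > 0` and every real `a`: `(D_a, D_a)_β ≤ Σ_x a_x²/(βU)`, `D_a = Σ_x a_x (n_x - 1)`; with Fourier
modes this is `β(δn_q, δn_{-q}) ≤ 1/U` (their (5)); by pseudospin symmetry it is also their on-site
pairing bound (6). [cite: KuboKishi1990, Theorem 2, eq. (5)] -/
theorem kuboKishi_charge_duhamel_le (hKK : kuboKishi_charge_gaussianDomination) (ε : Λ → ℤˣ)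
    (hε : ∀ x y, G.Adj x y → ε x = -ε y) {t U β : ℝ} (hU : 0 < U) (hβ : 0 < β) (a : Λ → ℝ) :
    (duhamel β (hamiltonianWith G t U (U / 2)) (chargeDensityField a) (chargeDensityField a)).re ≤
      (∑ x, a x ^ 2) / U / β := by
  refine gaussianDomination_duhamel_le_holds (Finset (Orb Λ)) β hβ _ _
    (isHermitian_hamiltonianWith G t U (U / 2)) (isHermitian_chargeDensityField a) _ fun τ => ?_
  have h := hKK Λ G ε hε t U β hU hβ (fun x => τ * a x)
  have hc : (∑ x, (τ * a x) ^ 2) / (2 * U) = τ ^ 2 * ((∑ x, a x ^ 2) / U) / 2 := by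
    rw [sum_sq_mul]; ring
  rw [chargeDensityField_smul, hc] at h
  exact h

/-! ### Consequences, proved: the Falk–Bruch transfer (Kubo–Kishi Remark 1 / Remark 3) -/

/-- **Equal-time spin fluctuations of the attractive model (PROVED from the named fact):** for
`U < 0`, any `μ`, `β > 0` and every finite family of real test functions `a_k`,
`Σ_k ⟨M_{a_k}²⟩_β ≤ B/(β|U|) + ½ √((B/|U|) · Σ_k ⟨[M_{a_k}, [H, M_{a_k}]]⟩_β)`, `B = Σ_k Σ_x a_{k,x}²`
— Kubo–Kishi's (4) with `coth x ≤ 1 + 1/x` and THEIR `C_q` kept as the (non-negative) thermal double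
commutator; the f-sum evaluation `⟨[M_a,[H,M_a]]⟩ = Σ_{b={x,y}} (a_x - a_y)² e_b`, `0 ≤ Σ ≤ 2|t| Σ_b
(a_x - a_y)²`, is carried out in the companion text (bounds.tex Thm 11). Proof: the tree's
Falk–Bruch inequality `Matrix.falkBruch_sum_le_of_le` fed with `kuboKishi_spin_duhamel_le`.
[cite: KuboKishi1990, Remark 1, eq. (4)] -/
theorem kuboKishi_spin_falkBruch_le (hKK : kuboKishi_spin_gaussianDomination) {t U μ β : ℝ}
    (hU : U < 0) (hβ : 0 < β) {ι : Type*} [Fintype ι] (a : ι → Λ → ℝ) :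
    ∑ k, (gibbsState β (hamiltonianWith G t U μ)
        (spinDensityField (a k) * spinDensityField (a k))).re ≤
      (∑ k, ∑ x, a k x ^ 2) / |U| / β +
        1 / 2 * Real.sqrt ((∑ k, ∑ x, a k x ^ 2) / |U| *
          ∑ k, (gibbsState β (hamiltonianWith G t U μ)
            (spinDensityField (a k) * (hamiltonianWith G t U μ * spinDensityField (a k) -
                spinDensityField (a k) * hamiltonianWith G t U μ) -
              (hamiltonianWith G t U μ * spinDensityField (a k) -
                spinDensityField (a k) * hamiltonianWith G t U μ) * spinDensityField (a k))).re) := by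
  have hb : ∑ k, (duhamel β (hamiltonianWith G t U μ) (spinDensityField (a k))
      (spinDensityField (a k))).re ≤ (∑ k, ∑ x, a k x ^ 2) / |U| / β := by
    rw [Finset.sum_div, Finset.sum_div]
    exact sum_le_sum fun k _ => kuboKishi_spin_duhamel_le G hKK hU hβ (a k)
  have h := falkBruch_sum_le_of_le (isHermitian_hamiltonianWith G t U μ) hβ.le
    (A := fun k => spinDensityField (a k)) (fun k => isHermitian_spinDensityField (a k)) hb
  have hβb : β * ((∑ k, ∑ x, a k x ^ 2) / |U| / β) = (∑ k, ∑ x, a k x ^ 2) / |U| := by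
    field_simp
  rw [hβb] at h
  exact h

/-- **Equal-time charge fluctuations of the repulsive half-filled model on a bipartite graph
(PROVED from the named fact):** for `U > 0`, `μ = U/2`, a bipartite sign, `β > 0` and every finite
family of real test functions `a_k`,
`Σ_k ⟨D_{a_k}²⟩_β ≤ B/(βU) + ½ √((B/U) · Σ_k ⟨[D_{a_k}, [H, D_{a_k}]]⟩_β)`, `B = Σ_k Σ_x a_{k,x}²`
(`D_a = Σ a_x (n_x - 1) = Σ a_x δn_x` at half filling) — the quantitative form of Kubo–Kishi's
Remark 3 (no CDW / on-site pairing long-range order at any `T > 0`); double commutator as in the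
spin case. [cite: KuboKishi1990, Theorem 2 and Remark 3] -/
theorem kuboKishi_charge_falkBruch_le (hKK : kuboKishi_charge_gaussianDomination) (ε : Λ → ℤˣ)
    (hε : ∀ x y, G.Adj x y → ε x = -ε y) {t U β : ℝ} (hU : 0 < U) (hβ : 0 < β) {ι : Type*}
    [Fintype ι] (a : ι → Λ → ℝ) :
    ∑ k, (gibbsState β (hamiltonianWith G t U (U / 2))
        (chargeDensityField (a k) * chargeDensityField (a k))).re ≤
      (∑ k, ∑ x, a k x ^ 2) / U / β +
        1 / 2 * Real.sqrt ((∑ k, ∑ x, a k x ^ 2) / U *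
          ∑ k, (gibbsState β (hamiltonianWith G t U (U / 2))
            (chargeDensityField (a k) * (hamiltonianWith G t U (U / 2) * chargeDensityField (a k) -
                chargeDensityField (a k) * hamiltonianWith G t U (U / 2)) -
              (hamiltonianWith G t U (U / 2) * chargeDensityField (a k) -
                chargeDensityField (a k) * hamiltonianWith G t U (U / 2)) *
                chargeDensityField (a k))).re) := by
  have hb : ∑ k, (duhamel β (hamiltonianWith G t U (U / 2)) (chargeDensityField (a k))
      (chargeDensityField (a k))).re ≤ (∑ k, ∑ x, a k x ^ 2) / U / β := by
    rw [Finset.sum_div, Finset.sum_div]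
    exact sum_le_sum fun k _ => kuboKishi_charge_duhamel_le G hKK ε hε hU hβ (a k)
  have h := falkBruch_sum_le_of_le (isHermitian_hamiltonianWith G t U (U / 2)) hβ.le
    (A := fun k => chargeDensityField (a k)) (fun k => isHermitian_chargeDensityField (a k)) hb
  have hβb : β * ((∑ k, ∑ x, a k x ^ 2) / U / β) = (∑ k, ∑ x, a k x ^ 2) / U := by
    field_simp
  rw [hβb] at h
  exact h

end Consequences

/-! ### The repulsive statements on the torus `(ℤ/Lℤ)^d`, `L` even, every `d` -/

section Torus

variable (d L : ℕ)

/-- **Kubo–Kishi (5) on the torus `(ℤ/Lℤ)^d`, `L` even** (bipartite sign `torusStagger`): for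
`U > 0`, `μ = U/2`, `β > 0`, every `d ≥ 1` and every real `a`, `(D_a, D_a)_β ≤ Σ_x a_x²/(βU)` for the
grand-canonical Hubbard torus `hubbardTorusWith d L t U (U/2)`. Valid in EVERY dimension (it is not
a Mermin–Wagner statement). [cite: KuboKishi1990, Theorem 2, eq. (5)] -/
theorem kuboKishi_charge_duhamel_le_torus (hKK : kuboKishi_charge_gaussianDomination)
    (hL : Even L) {t U β : ℝ} (hU : 0 < U) (hβ : 0 < β) (a : FermionTorus d L → ℝ) :
    (duhamel β (hubbardTorusWith d L t U (U / 2)) (chargeDensityField a)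
        (chargeDensityField a)).re ≤ (∑ x, a x ^ 2) / U / β := by
  have hHG : hubbardTorusWith d L t U (U / 2) = hamiltonianWith (fermionTorusGraph d L) t U (U / 2) :=
    rfl
  rw [hHG]
  -- `convert`: the statement carries the torus's structural `DecidableEq` instance on the orbitals,
  -- the generic lemma the one derived from the linear order (equal by `Subsingleton.elim`)
  convert kuboKishi_charge_duhamel_le (fermionTorusGraph d L) hKK torusStagger
    (fun _ _ h => torusStagger_eq_neg_of_adj_holds hL h) (t := t) hU hβ a using 3

/-- **The Falk–Bruch form on the torus `(ℤ/Lℤ)^d`, `L` even**: for `U > 0`, `μ = U/2`, `β > 0` and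
every finite family `a_k`,
`Σ_k ⟨D_{a_k}²⟩ ≤ B/(βU) + ½ √((B/U) Σ_k ⟨[D_{a_k},[H,D_{a_k}]]⟩)`, `B = Σ_k Σ_x a_{k,x}²`. With the two
Fourier modes `cos(q·x)`, `sin(q·x)` (`B = L^d`) and the f-sum value of the double commutator this
is the charge-structure-factor ceiling `S^{cc}(q) ≤ 1/(βU) + √(ε_q|t|/U)` of bounds.tex Thm 11;
with `a = torusStagger` (`B = L^d`, double commutator `= 4·(-⟨T⟩) ≤ 8d|t|L^d`) and pseudospin
symmetry it is the on-site pair-field ceiling `⟨Δ_s†Δ_s⟩/L^d ≤ 1/(2βU) + ½√(k/U)`, `k ≤ 2d|t|` the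
kinetic energy per site. [cite: KuboKishi1990, Theorem 2 and Remark 3] -/
theorem kuboKishi_charge_falkBruch_le_torus (hKK : kuboKishi_charge_gaussianDomination)
    (hL : Even L) {t U β : ℝ} (hU : 0 < U) (hβ : 0 < β) {ι : Type*} [Fintype ι]
    (a : ι → FermionTorus d L → ℝ) :
    ∑ k, (gibbsState β (hubbardTorusWith d L t U (U / 2))
        (chargeDensityField (a k) * chargeDensityField (a k))).re ≤
      (∑ k, ∑ x, a k x ^ 2) / U / β +
        1 / 2 * Real.sqrt ((∑ k, ∑ x, a k x ^ 2) / U *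
          ∑ k, (gibbsState β (hubbardTorusWith d L t U (U / 2))
            (chargeDensityField (a k) *
                (hubbardTorusWith d L t U (U / 2) * chargeDensityField (a k) -
                  chargeDensityField (a k) * hubbardTorusWith d L t U (U / 2)) -
              (hubbardTorusWith d L t U (U / 2) * chargeDensityField (a k) -
                  chargeDensityField (a k) * hubbardTorusWith d L t U (U / 2)) *
                chargeDensityField (a k))).re) := by
  have hHG : hubbardTorusWith d L t U (U / 2) = hamiltonianWith (fermionTorusGraph d L) t U (U / 2) :=
    rfl
  rw [hHG]
  convert kuboKishi_charge_falkBruch_le (fermionTorusGraph d L) hKK torusStagger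
    (fun _ _ h => torusStagger_eq_neg_of_adj_holds hL h) (t := t) hU hβ a using 10

/-- **Kubo–Kishi (3) on the torus, attractive model**: for `U < 0`, any `μ`, `β > 0`, every `d`, `L`
and every real `a`, `(M_a, M_a)_β ≤ Σ_x a_x²/(β|U|)` for `hubbardTorusWith d L t U μ`.
[cite: KuboKishi1990, Theorem 1, eq. (3)] -/
theorem kuboKishi_spin_duhamel_le_torus (hKK : kuboKishi_spin_gaussianDomination) {t U μ β : ℝ}
    (hU : U < 0) (hβ : 0 < β) (a : FermionTorus d L → ℝ) :
    (duhamel β (hubbardTorusWith d L t U μ) (spinDensityField a) (spinDensityField a)).re ≤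
      (∑ x, a x ^ 2) / |U| / β := by
  have hHG : hubbardTorusWith d L t U μ = hamiltonianWith (fermionTorusGraph d L) t U μ := rfl
  rw [hHG]
  convert kuboKishi_spin_duhamel_le (fermionTorusGraph d L) hKK (t := t) (μ := μ) hU hβ a using 3

end Torus

end Literature.MathematicalPhysics.QuantumLattice

end
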